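import Summits.Ventures.LatticeQCDFlow.Exactness.Phi4MetropolisMagnetisationTunnelling
import Summits.Ventures.LatticeQCDFlow.Exactness.Phi4PhaseLabelFlipRateHMCFlow
import HarnessLib

/-!
# The FLOW arm: the exact flow sampler is a reversible `L²(e^{−S})` CONTRACTION on bounded observables, and the cross-observable floor `τ_int(g) ≥ ⟨g θ⟩²/(⟨g²⟩ · 2 r_flip) − ½`

HONEST FRAMING: exact (Metropolis-corrected) sampling algorithms for lattice gauge theory;
figures of merit are autocorrelation/cost numbers at stated couplings and volumes; no
continuum-physics claim.  (SCALAR calibration rung S0-A: not a gauge result.)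

Venture `LatticeQCDFlow` (cell pub-lqcd), topic `Exactness`; FANOUT row 2 (`s0-phi4`, the FLOW arm:
independence Metropolis with target `w = e^{−S}` and ANY positive model density `q̃`, `∫ q̃ = 1`;
general measurable space first, then lattice φ⁴ `imhOpPhi4 J λ q̃`).  NEW WORK of the cell: the
tree's flow-sampler toolbox (`FlowSamplerOperator`, `FlowSamplerLogConvex.imhOp_add_mul` /
`integral_imhOp_mul_mul_comm`, `IMHDirichletForm.dirichlet_eq_half_sq`) lacked the CONTRACTION
property `∫ (K f)² w ≤ ∫ f² w` on bounded observables (its `τ_int` floors went through positivity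
instead); it is proved here (pointwise Jensen `(K f)² ≤ K(f²)` by the weighted Cauchy–Schwarz steps
`sq_integral_le_integral_mul_integral` / `sq_add_mul_le`, then exactness), which makes the flow
sampler an instance of the `RevOp` format and hence of the variational floor
(`Exactness/ReversibleVariationalFloorThinned.lean`).  Nothing is cited as a fact.

## What is proved

General space `(X, μ)` (s-finite), `w > 0` integrable, `q > 0` measurable integrable with `∫ q = 1`,
`K = imhOp μ w q`:
* `imhOp_one` — `K 1 = 1`; `imhOp_eq_jump_add_hold` — `(K f)(t) = ∫ a(t,·) q f + (1 − ∫ a(t,·) q) f(t)`;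
* **`imhOp_sq_le_imhOp_sq`** — `(K f)(t)² ≤ K(f²)(t)` for bounded measurable `f` (Jensen);
* **`integral_imhOp_sq_le_integral_sq`** — `∫ (K f)² w ≤ ∫ f² w` (the contraction property);
* **`imhOp_tauInt_ge_cross`** — CROSS-OBSERVABLE FLOOR: `g` bounded measurable, `θ = ±1` the label
  of a measurable `F` at level `c`, `R = ∫∫ min(w q̃', w' q̃) χ_flip` (so that `R/Z` is the
  probability per step of an ACCEPTED label change); if the autocorrelation series of `g` is summable
  then `τ_int(g) ≥ (∫ g θ w)² / (∫ g² w · 2R) − ½`.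

Lattice φ⁴ (`λ > 0`, real `J`, every positive model density): **`phi4Flow_tauInt_ge_cross`** —
`τ_int(g) ≥ ⟨g θ⟩² / (⟨g²⟩ · 2 r) − ½` for every bounded measurable `g` and label `θ`, `r` the
equilibrium probability per flow proposal of an accepted label change; with `θ = sgn M` and
`g = clip_L(M) − ⟨clip_L(M)⟩` or any bounded observable odd under `φ ↦ −φ` this prices the flow
arm's tunnelling events against every such observable's `τ_int` column (all three arms now:
`Phi4MetropolisMagnetisationTunnelling`, `Phi4HMCMagnetisationTunnelling`, this file).
NOT CLAIMED: unbounded `g` (the magnetisation itself needs a first-moment hypothesis on `q̃`);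
summability for any run; any value of `r` for a trained network.
-/

namespace Summit.Ventures.LatticeQCDFlow.Exactness

open Real MeasureTheory Filter Finset
open Summit.Ventures.LatticeQCDFlow.Scoring

section General

variable {X : Type*} [MeasurableSpace X] {μ : Measure X} {w q : X → ℝ}

/-- `K 1 = 1`: the flow sampler is a Markov operator. -/
theorem imhOp_one (hq1 : ∫ t, q t ∂μ = 1) (t : X) : imhOp μ w q (fun _ => (1 : ℝ)) t = 1 := by
  unfold imhOp
  have e : ∀ t', (imhAcceptQ w q t t' * (1 : ℝ) + (1 - imhAcceptQ w q t t') * 1) * q t' = q t' :=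
    fun t' => by ring
  simp_rw [e]
  exact hq1

/-- **Jump + hold decomposition**: `(K f)(t) = ∫ a(t,t') f(t') q(t') dt' + (1 − ∫ a(t,t') q(t') dt') f(t)`. -/
theorem imhOp_eq_jump_add_hold (hw0 : ∀ t, 0 < w t) (hwm : Measurable w) (hq0 : ∀ t, 0 < q t)
    (hqm : Measurable q) (hqi : Integrable q μ) (hq1 : ∫ t, q t ∂μ = 1)
    {f : X → ℝ} (hfm : Measurable f) {B : ℝ} (hfb : ∀ t, |f t| ≤ B) (t : X) :
    imhOp μ w q f t
      = (∫ t', imhAcceptQ w q t t' * q t' * f t' ∂μ)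
        + (1 - ∫ t', imhAcceptQ w q t t' * q t' ∂μ) * f t := by
  have ha0 : ∀ t', 0 ≤ imhAcceptQ w q t t' := fun t' => imhAcceptQ_nonneg hw0 hq0 t t'
  have ha1 : ∀ t', imhAcceptQ w q t t' ≤ 1 := fun t' => imhAcceptQ_le_one w q t t'
  have ham : Measurable fun t' => imhAcceptQ w q t t' :=
    (measurable_imhAcceptQ hwm hqm).comp (measurable_const.prodMk measurable_id)
  have haq : Integrable (fun t' => imhAcceptQ w q t t' * q t') μ := by
    refine Integrable.mono' hqi (ham.mul hqm).aestronglyMeasurable (Eventually.of_forall fun t' => ?_)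
    rw [Real.norm_eq_abs, abs_mul, abs_of_nonneg (ha0 t'), abs_of_pos (hq0 t')]
    calc imhAcceptQ w q t t' * q t' ≤ 1 * q t' := mul_le_mul_of_nonneg_right (ha1 t') (hq0 t').le
      _ = q t' := one_mul _
  have haqf : Integrable (fun t' => imhAcceptQ w q t t' * q t' * f t') μ := by
    refine Integrable.mono' (hqi.const_mul B) ((ham.mul hqm).mul hfm).aestronglyMeasurable
      (Eventually.of_forall fun t' => ?_)
    rw [Real.norm_eq_abs, abs_mul, abs_mul, abs_of_nonneg (ha0 t'), abs_of_pos (hq0 t')]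
    calc imhAcceptQ w q t t' * q t' * |f t'| ≤ 1 * q t' * B :=
          mul_le_mul (mul_le_mul_of_nonneg_right (ha1 t') (hq0 t').le) (hfb t') (abs_nonneg _)
            (by rw [one_mul]; exact (hq0 t').le)
      _ = B * q t' := by ring
  unfold imhOp
  have e : ∀ t', (imhAcceptQ w q t t' * f t' + (1 - imhAcceptQ w q t t') * f t) * q t'
      = imhAcceptQ w q t t' * q t' * f t' + f t * (q t' - imhAcceptQ w q t t' * q t') :=
    fun t' => by ring
  have hsub : Integrable (fun t' => q t' - imhAcceptQ w q t t' * q t') μ := hqi.sub haq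
  have hI2 : Integrable (fun t' => f t * (q t' - imhAcceptQ w q t t' * q t')) μ := hsub.const_mul (f t)
  simp_rw [e]
  rw [integral_add haqf hI2, integral_const_mul, integral_sub hqi haq, hq1]
  ring

/-- **Pointwise Jensen: `(K f)(t)² ≤ K(f²)(t)`** for bounded measurable `f` (the one-step law from `t`
is a probability measure: the jump part `a q dt'` plus the holding mass `1 − ∫ a q`). -/
theorem imhOp_sq_le_imhOp_sq (hw0 : ∀ t, 0 < w t) (hwm : Measurable w) (hq0 : ∀ t, 0 < q t)
    (hqm : Measurable q) (hqi : Integrable q μ) (hq1 : ∫ t, q t ∂μ = 1)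
    {f : X → ℝ} (hfm : Measurable f) {B : ℝ} (hfb : ∀ t, |f t| ≤ B) (t : X) :
    imhOp μ w q f t ^ 2 ≤ imhOp μ w q (fun s => f s ^ 2) t := by
  have hfb2 : ∀ s, |f s ^ 2| ≤ B ^ 2 := fun s => by
    rw [abs_pow]; exact pow_le_pow_left₀ (abs_nonneg _) (hfb s) 2
  have ha0 : ∀ t', 0 ≤ imhAcceptQ w q t t' := fun t' => imhAcceptQ_nonneg hw0 hq0 t t'
  have ha1 : ∀ t', imhAcceptQ w q t t' ≤ 1 := fun t' => imhAcceptQ_le_one w q t t'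
  have ham : Measurable fun t' => imhAcceptQ w q t t' :=
    (measurable_imhAcceptQ hwm hqm).comp (measurable_const.prodMk measurable_id)
  set m : X → ℝ := fun t' => imhAcceptQ w q t t' * q t' with hm
  have hm0 : ∀ t', 0 ≤ m t' := fun t' => mul_nonneg (ha0 t') (hq0 t').le
  have hmm : Measurable m := ham.mul hqm
  have hmi : Integrable m μ := by
    refine Integrable.mono' hqi hmm.aestronglyMeasurable (Eventually.of_forall fun t' => ?_)
    rw [Real.norm_eq_abs, abs_of_nonneg (hm0 t')]
    calc m t' = imhAcceptQ w q t t' * q t' := rfl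
      _ ≤ 1 * q t' := mul_le_mul_of_nonneg_right (ha1 t') (hq0 t').le
      _ = q t' := one_mul _
  -- the holding mass is nonnegative: `∫ a q ≤ ∫ q = 1`
  have hU1 : ∫ t', m t' ∂μ ≤ 1 := by
    rw [← hq1]
    exact integral_mono hmi hqi fun t' => by
      calc m t' = imhAcceptQ w q t t' * q t' := rfl
        _ ≤ 1 * q t' := mul_le_mul_of_nonneg_right (ha1 t') (hq0 t').le
        _ = q t' := one_mul _
  have hU0 : 0 ≤ ∫ t', m t' ∂μ := integral_nonneg hm0
  have hCS := sq_integral_le_integral_mul_integral (μ := μ) hm0 hmm hmi hfm hfb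
  have hv0 : 0 ≤ ∫ t', m t' * f t' ^ 2 ∂μ := integral_nonneg fun t' => mul_nonneg (hm0 t') (sq_nonneg _)
  have key := sq_add_mul_le (x := f t) hU0 (sub_nonneg.2 hU1) hv0 hCS
  rw [imhOp_eq_jump_add_hold hw0 hwm hq0 hqm hqi hq1 hfm hfb t,
    imhOp_eq_jump_add_hold hw0 hwm hq0 hqm hqi hq1 (hfm.pow_const 2) hfb2 t]
  calc ((∫ t', imhAcceptQ w q t t' * q t' * f t' ∂μ)
        + (1 - ∫ t', imhAcceptQ w q t t' * q t' ∂μ) * f t) ^ 2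
      ≤ ((∫ t', m t' ∂μ) + (1 - ∫ t', m t' ∂μ))
          * ((∫ t', m t' * f t' ^ 2 ∂μ) + (1 - ∫ t', m t' ∂μ) * f t ^ 2) := key
    _ = (∫ t', imhAcceptQ w q t t' * q t' * f t' ^ 2 ∂μ)
          + (1 - ∫ t', imhAcceptQ w q t t' * q t' ∂μ) * f t ^ 2 := by
        rw [hm]; ring

variable [SFinite μ]

/-- **THE FLOW SAMPLER IS AN `L²(w)`-CONTRACTION on bounded observables**: `∫ (K f)² w ≤ ∫ f² w`
(pointwise Jensen, then exactness `∫ (K h) w = ∫ h w` at `h = f²`). -/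
theorem integral_imhOp_sq_le_integral_sq (hw0 : ∀ t, 0 < w t) (hwm : Measurable w)
    (hwi : Integrable w μ) (hq0 : ∀ t, 0 < q t) (hqm : Measurable q) (hqi : Integrable q μ)
    (hq1 : ∫ t, q t ∂μ = 1) {f : X → ℝ} (hfm : Measurable f) {B : ℝ} (hfb : ∀ t, |f t| ≤ B) :
    ∫ t, imhOp μ w q f t ^ 2 * w t ∂μ ≤ ∫ t, f t ^ 2 * w t ∂μ := by
  have hfb2 : ∀ s, |f s ^ 2| ≤ B ^ 2 := fun s => by
    rw [abs_pow]; exact pow_le_pow_left₀ (abs_nonneg _) (hfb s) 2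
  have hKm : Measurable (imhOp μ w q f) := measurable_imhOp hwm hqm hfm
  have hKb : ∀ t, |imhOp μ w q f t| ≤ B := imhOp_abs_le hw0 hq0 hqi hq1 hfb
  have hK2m : Measurable (imhOp μ w q fun s => f s ^ 2) := measurable_imhOp hwm hqm (hfm.pow_const 2)
  have hK2b : ∀ t, |imhOp μ w q (fun s => f s ^ 2) t| ≤ B ^ 2 := imhOp_abs_le hw0 hq0 hqi hq1 hfb2
  have h1b : ∀ t : X, |(fun _ : X => (1 : ℝ)) t| ≤ 1 := fun _ => by simp
  have iL : Integrable (fun t => imhOp μ w q f t ^ 2 * w t) μ := by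
    have h := integrable_mul_mul_weight hw0 hwm hwi hKm hKm hKb hKb
    exact h.congr (Eventually.of_forall fun t => by simp only [sq])
  have iR : Integrable (fun t => imhOp μ w q (fun s => f s ^ 2) t * w t) μ := by
    have h := integrable_mul_mul_weight hw0 hwm hwi hK2m measurable_const hK2b h1b
    exact h.congr (Eventually.of_forall fun t => by simp only [mul_one])
  calc ∫ t, imhOp μ w q f t ^ 2 * w t ∂μ
      ≤ ∫ t, imhOp μ w q (fun s => f s ^ 2) t * w t ∂μ :=
        integral_mono iL iR fun t => mul_le_mul_of_nonneg_right
          (imhOp_sq_le_imhOp_sq hw0 hwm hq0 hqm hqi hq1 hfm hfb t) (hw0 t).le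
    _ = ∫ t, f t ^ 2 * w t ∂μ :=
        integral_imhOp_mul hw0 hwm hwi hq0 hqm hqi hq1 (hfm.pow_const 2) hfb2

/-- **THE CROSS-OBSERVABLE FLOOR OF THE FLOW SAMPLER (general space).**  `g` bounded measurable,
`F` measurable, `c` a level, `θ = ±1` the label of `{c ≤ F}`,
`R = ∫∫ min(w(t) q(t'), w(t') q(t)) χ_flip(t, t')` (`R/Z` = probability per step of an accepted label
change).  If the autocorrelation series of `g` under `K = imhOp μ w q` is summable, then
`τ_int(g) ≥ (∫ g θ w)² / (∫ g² w · 2R) − ½`. -/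
theorem imhOp_tauInt_ge_cross (hw0 : ∀ t, 0 < w t) (hwm : Measurable w) (hwi : Integrable w μ)
    (hq0 : ∀ t, 0 < q t) (hqm : Measurable q) (hqi : Integrable q μ) (hq1 : ∫ t, q t ∂μ = 1)
    {g : X → ℝ} (hgm : Measurable g) {Bg : ℝ} (hgb : ∀ t, |g t| ≤ Bg)
    {F : X → ℝ} (hF : Measurable F) (c : ℝ)
    (hs : Summable fun k => (∫ t, g t * ((imhOp μ w q)^[k + 1] g) t * w t ∂μ)
      / ∫ t, g t ^ 2 * w t ∂μ) :
    (∫ t, g t * (if c ≤ F t then (1 : ℝ) else -1) * w t ∂μ) ^ 2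
          / ((∫ t, g t ^ 2 * w t ∂μ) * (2 * ∫ p, imhFlow w q p.1 p.2
            * (if (c ≤ F p.1 ↔ c ≤ F p.2) then (0 : ℝ) else 1) ∂(μ.prod μ))) - 1 / 2
      ≤ tauInt (fun k => (∫ t, g t * ((imhOp μ w q)^[k] g) t * w t ∂μ) / ∫ t, g t ^ 2 * w t ∂μ) := by
  -- the label and its Dirichlet form `2R`
  have hθm : Measurable (fun t => if c ≤ F t then (1 : ℝ) else -1) :=
    Measurable.ite (measurableSet_le measurable_const hF) measurable_const measurable_const
  have hθb : ∀ t, |(if c ≤ F t then (1 : ℝ) else -1)| ≤ 1 := fun t => by split_ifs <;> norm_num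
  have hdir := dirichlet_eq_half_sq hw0 hwm hwi hq0 hqm hqi hq1 hθm hθb
  have hdir' : (∫ t, (if c ≤ F t then (1 : ℝ) else -1) ^ 2 * w t ∂μ)
      - ∫ t, (if c ≤ F t then (1 : ℝ) else -1)
          * imhOp μ w q (fun s => if c ≤ F s then (1 : ℝ) else -1) t * w t ∂μ
      ≤ 2 * ∫ p, imhFlow w q p.1 p.2 * (if (c ≤ F p.1 ↔ c ≤ F p.2) then (0 : ℝ) else 1) ∂(μ.prod μ) := by
    rw [hdir]
    have e : ∀ p : X × X, imhFlow w q p.1 p.2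
          * ((if c ≤ F p.1 then (1 : ℝ) else -1) - (if c ≤ F p.2 then (1 : ℝ) else -1)) ^ 2
        = 4 * (imhFlow w q p.1 p.2 * (if (c ≤ F p.1 ↔ c ≤ F p.2) then (0 : ℝ) else 1)) := by
      intro p
      rw [label_sq_sub_eq_four_mul_flip]
      ring
    simp_rw [e]
    rw [integral_const_mul]
    linarith
  -- the flow sampler as an instance of the `RevOp` format on bounded measurable observables
  exact RevOp.tauInt_ge_variational_of_le (μ := μ)
    (A := fun f : X → ℝ => Measurable f ∧ ∃ B : ℝ, ∀ t, |f t| ≤ B)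
    (K := imhOp μ w q) (w := w) (fun t => (hw0 t).le)
    (fun f h hf hh => by
      obtain ⟨hfm', Bf, hfb'⟩ := hf
      obtain ⟨hhm', Bh, hhb'⟩ := hh
      exact integrable_mul_mul_weight hw0 hwm hwi hfm' hhm' hfb' hhb')
    (fun f h l hf hh => by
      obtain ⟨hfm', Bf, hfb'⟩ := hf
      obtain ⟨hhm', Bh, hhb'⟩ := hh
      refine ⟨hfm'.add (measurable_const.mul hhm'), Bf + |l| * Bh, fun t => ?_⟩
      calc |f t + l * h t| ≤ |f t| + |l * h t| := abs_add_le _ _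
        _ ≤ Bf + |l| * Bh := by
            rw [abs_mul]; exact add_le_add (hfb' t) (mul_le_mul_of_nonneg_left (hhb' t) (abs_nonneg _)))
    (fun f hf => by
      obtain ⟨hfm', Bf, hfb'⟩ := hf
      exact ⟨measurable_imhOp hwm hqm hfm', Bf, imhOp_abs_le hw0 hq0 hqi hq1 hfb'⟩)
    (fun f h l hf hh t => by
      obtain ⟨hfm', Bf, hfb'⟩ := hf
      obtain ⟨hhm', Bh, hhb'⟩ := hh
      exact imhOp_add_mul hw0 hwm hq0 hqm hqi hfm' hhm' hfb' hhb' l t)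
    (fun f h hf hh => by
      obtain ⟨hfm', Bf, hfb'⟩ := hf
      obtain ⟨hhm', Bh, hhb'⟩ := hh
      exact integral_imhOp_mul_mul_comm hw0 hwm hwi hq0 hqm hqi hfm' hhm' hfb' hhb')
    (fun f hf => by
      obtain ⟨hfm', Bf, hfb'⟩ := hf
      exact integral_imhOp_sq_le_integral_sq hw0 hwm hwi hq0 hqm hqi hq1 hfm' hfb')
    ⟨hgm, Bg, hgb⟩ ⟨hθm, 1, hθb⟩ hs hdir'

end General

/-! ## Lattice φ⁴: the flow arm -/

section Lattice

variable {n : ℕ}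

/-- **THE CROSS-OBSERVABLE FLOOR OF ROW 2's FLOW ARM.**  Every `λ > 0`, real `J`, positive measurable
model density `q̃` with `∫ q̃ = 1` (`K = imhOpPhi4 J λ q̃`); `g` bounded measurable, `θ = ±1` the label
of a measurable `F` at level `c`;
`r = Z⁻¹ ∫∫ min(e^{−S(φ)} q̃(φ'), e^{−S(φ')} q̃(φ)) χ_flip(φ, φ')` the equilibrium probability per step
of an accepted label change.  If the autocorrelation series of `g` is summable, then
`τ_int(g) ≥ ⟨g θ⟩² / (⟨g²⟩ · 2 r) − ½`. -/
theorem phi4Flow_tauInt_ge_cross {lam : ℝ} (hlam : 0 < lam) (J : Fin (n + 1) → Fin (n + 1) → ℝ)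
    {q : (Fin (n + 1) → ℝ) → ℝ} (hq0 : ∀ φ, 0 < q φ) (hqm : Measurable q) (hqi : Integrable q)
    (hq1 : ∫ φ, q φ = 1) {g : (Fin (n + 1) → ℝ) → ℝ} (hg : BddObs g)
    {F : (Fin (n + 1) → ℝ) → ℝ} (hF : Measurable F) (c : ℝ)
    (hs : Summable fun k => (∫ φ, g φ * ((imhOpPhi4 J lam q)^[k + 1] g) φ * gibbsWeight J lam φ)
        / ∫ φ, g φ ^ 2 * gibbsWeight J lam φ) :
    gibbsExpect J lam (fun φ => g φ * (if c ≤ F φ then (1 : ℝ) else -1)) ^ 2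
        / (gibbsExpect J lam (fun φ => g φ ^ 2)
          * (2 * ((∫ p, imhFlow (gibbsWeight J lam) q p.1 p.2
            * (if (c ≤ F p.1 ↔ c ≤ F p.2) then (0 : ℝ) else 1)
              ∂((volume : Measure (Fin (n + 1) → ℝ)).prod volume)) / gibbsZ J lam))) - 1 / 2
      ≤ tauInt (fun k => (∫ φ, g φ * ((imhOpPhi4 J lam q)^[k] g) φ * gibbsWeight J lam φ)
        / ∫ φ, g φ ^ 2 * gibbsWeight J lam φ) := by
  have hZ := gibbsZ_pos hlam J
  have hwi := integrable_gibbsWeight hlam J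
  have hw0 : ∀ φ : Fin (n + 1) → ℝ, 0 < gibbsWeight J lam φ := fun φ => gibbsWeight_pos J lam φ
  have hwm : Measurable (gibbsWeight J lam) := (continuous_gibbsWeight J lam).measurable
  obtain ⟨hgm, Bg, hgb⟩ := hg
  rw [imhOpPhi4_eq_imhOp] at hs ⊢
  have h := imhOp_tauInt_ge_cross (μ := volume) hw0 hwm hwi hq0 hqm hqi hq1 hgm hgb hF c hs
  unfold gibbsExpect
  have e : ∀ B P R : ℝ, (B / gibbsZ J lam) ^ 2 / (P / gibbsZ J lam * (2 * (R / gibbsZ J lam)))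
      = B ^ 2 / (P * (2 * R)) := fun B P R => cross_floor_transfer hZ.ne' B P R 2
  rw [e]
  exact h

end Lattice

end Summit.Ventures.LatticeQCDFlow.Exactness
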